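import Summits.QuantumFields.YangMills.Theorems.TwistEaterVolumeQuadraticGrowthRing
import Literature.MathematicalPhysics.QuantumFieldTheory.Balaban1983to89.T4WilsonGaugeFlatDirection
import HarnessLib

/-!
# The zero set of the twisted ring deficit `F_z`: constant flat rings with a twist-periodic seam
# (layer (B1a) of the DIRECT Laplace road to ⟨stmt-QuantumFields-24204⟩ `VirialFluxGap.SharpTwistedLaplace`)

Helper module (free-hands work of width seat ym-line-sfw-p2-w2 g49, cell ym-idea-1).  From ✓`ringDeficit_eq_sums` (the deficit
is a sum of non-negative squares: kinetic bond deficits `Σ_e ‖q(U_e) − q(V_e)‖²`, the seam deficit, and the spatial Wilson actions) we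
read off the EXACT zero set of `F_z` for every twist `z`:

★ `ringDeficit_eq_zero_iff` — `F_z(U⃗, g) = 0` iff all `2L` slices coincide (`U_i = U_0`), the common slice is FLAT (`S(U_0) = 0`), and the
seam gauge field eats the twist: `g · tw_z(U_0) = U_0`.

This is the first half of the classification of the critical set of the Laplace phase (the second half — flat + twist-periodic pairs
`(U_0, g)` modulo gauge are finitely many orbits of SU(2) twist-eaters for `z ≠ 0` — is the next file).  Everything here is PROVED; no
definitions, no named facts.  HONEST FRAMING: bookkeeping over landed lemmas; ⟨24204⟩, ⟨24319⟩ and every rung stay OPEN; the Yang–Mills mass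
gap (Clay) is NOT touched; no summit is proved by a line.
-/

noncomputable section

open scoped Quaternion Matrix BigOperators
open Literature.MathematicalPhysics.QuantumFieldTheory hiding SU2
open Literature.MathematicalPhysics.QuantumLattice
open Literature.MathematicalPhysics.QuantumFieldTheory.Balaban1983to89.T4WilsonGaugeFlatDirection (su2Quat_injective)
open Summit.QuantumFields.YangMills.Theorems.FemtoTransferGap
open Summit.QuantumFields.YangMills.Theorems.FemtoTransferGap.TT
open Summit.QuantumFields.YangMills.Theorems.ToronValleyVolume.Lojasiewicz
open Summit.QuantumFields.YangMills.Theorems.TwistEaterVolume.Quadratic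

namespace Summit.QuantumFields.YangMills.Theorems.VirialFluxGap.RingDeficit

variable {L : ℕ} [NeZero L]

/-- Two slices with vanishing kinetic bond deficit are equal (every link: `‖q(U_e) − q(V_e)‖² ≤ deficit`, `q` injective). [folklore] -/
theorem eq_of_timeCoupling_deficit_eq_zero {U V : GaugeConfig 3 L SU2} (h : 6 * (L : ℝ) ^ 3 - timeCoupling su2Rep U V = 0) :
    U = V := by
  funext e
  have h1 := norm_sq_le_timeCoupling_deficit U V e
  rw [h] at h1
  have h2 : ‖su2Quat (U e) - su2Quat (V e)‖ = 0 := by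
    have := sq_nonneg ‖su2Quat (U e) - su2Quat (V e)‖
    nlinarith [norm_nonneg (su2Quat (U e) - su2Quat (V e))]
  exact su2Quat_injective (sub_eq_zero.mp (norm_eq_zero.mp h2))

/-- ★ **The zero set of the twisted deficit.**  For every twist `z` and every ring history `(U⃗, g)`:
`F_z(U⃗, g) = 0 ↔ (∀ i, U_i = U_0) ∧ S(U_0) = 0 ∧ g · tw_z(U_0) = U_0`. [cite: Luscher1983, §2] -/
theorem ringDeficit_eq_zero_iff (z : Fin 3 → Bool) (P : (Fin (2 * L - 1 + 1) → GaugeConfig 3 L SU2) × (Site 3 L → SU2)) :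
    ringDeficit L z P = 0 ↔
      (∀ i, P.1 i = P.1 0) ∧ wilsonAction su2Rep (P.1 0) = 0 ∧ gaugeTransform P.2 (twist3 z (P.1 0)) = P.1 0 := by
  constructor
  · intro h0
    -- consecutive slices coincide
    have hstep : ∀ i : Fin (2 * L - 1), P.1 i.castSucc = P.1 i.succ := fun i => by
      have h1 := kinetic_le_ringDeficit_twist z P i
      have h2 := timeCoupling_su2Rep_le (P.1 i.castSucc) (P.1 i.succ)
      exact eq_of_timeCoupling_deficit_eq_zero (by linarith)
    have hall : ∀ i, P.1 i = P.1 0 := by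
      intro i
      induction i using Fin.induction with
      | zero => rfl
      | succ i ih => rw [← hstep i, ih]
    -- the seam
    have hseam : P.1 (Fin.last (2 * L - 1)) = gaugeTransform P.2 (twist3 z (P.1 0)) := by
      have h1 := seam_le_ringDeficit_twist z P
      have h2 := timeCoupling_su2Rep_le (P.1 (Fin.last (2 * L - 1))) (gaugeTransform P.2 (twist3 z (P.1 0)))
      exact eq_of_timeCoupling_deficit_eq_zero (by linarith)
    -- flatness
    have hflat : wilsonAction su2Rep (P.1 0) = 0 := by
      have h1 := wilsonAction_first_le_ringDeficit_twist z P
      have h2 := wilsonAction_su2_nonneg_lat (P.1 0)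
      linarith
    refine ⟨hall, hflat, ?_⟩
    rw [← hseam, hall]
  · rintro ⟨hall, hflat, hseam⟩
    rw [ringDeficit_eq_sums]
    have hk : ∀ i : Fin (2 * L - 1), 6 * (L : ℝ) ^ 3 - timeCoupling su2Rep (P.1 i.castSucc) (P.1 i.succ) = 0 := fun i => by
      rw [hall i.castSucc, hall i.succ]; exact timeCoupling_deficit_self _
    have hs : 6 * (L : ℝ) ^ 3 - timeCoupling su2Rep (P.1 (Fin.last (2 * L - 1))) (gaugeTransform P.2 (twist3 z (P.1 0))) = 0 := by
      rw [hall (Fin.last _), hseam]; exact timeCoupling_deficit_self _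
    have hS : ∀ i, wilsonAction su2Rep (P.1 i) = 0 := fun i => by rw [hall i]; exact hflat
    have hSg : wilsonAction su2Rep (gaugeTransform P.2 (twist3 z (P.1 0))) = 0 := by rw [hseam]; exact hflat
    simp [hk, hs, hS, hSg]

/-- On the zero set the ring is constant: every slice equals the first. [folklore] -/
theorem slice_eq_of_ringDeficit_eq_zero {z : Fin 3 → Bool} {P : (Fin (2 * L - 1 + 1) → GaugeConfig 3 L SU2) × (Site 3 L → SU2)}
    (h : ringDeficit L z P = 0) (i : Fin (2 * L - 1 + 1)) : P.1 i = P.1 0 :=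
  ((ringDeficit_eq_zero_iff z P).mp h).1 i

/-- On the zero set the common slice is flat. [folklore] -/
theorem wilsonAction_eq_zero_of_ringDeficit_eq_zero {z : Fin 3 → Bool}
    {P : (Fin (2 * L - 1 + 1) → GaugeConfig 3 L SU2) × (Site 3 L → SU2)} (h : ringDeficit L z P = 0) :
    wilsonAction su2Rep (P.1 0) = 0 :=
  ((ringDeficit_eq_zero_iff z P).mp h).2.1

/-- On the zero set the seam gauge field eats the twist: `g · tw_z(U_0) = U_0`. [cite: Luscher1983, §2] -/
theorem seam_eats_twist_of_ringDeficit_eq_zero {z : Fin 3 → Bool}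
    {P : (Fin (2 * L - 1 + 1) → GaugeConfig 3 L SU2) × (Site 3 L → SU2)} (h : ringDeficit L z P = 0) :
    gaugeTransform P.2 (twist3 z (P.1 0)) = P.1 0 :=
  ((ringDeficit_eq_zero_iff z P).mp h).2.2

end Summit.QuantumFields.YangMills.Theorems.VirialFluxGap.RingDeficit
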